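import Literature.AlgebraicGeometry.Resolution.PointBlowupAlgebraCharts
import HarnessLib

/-!
# The exceptional divisor of `Bl₀ 𝔸ⁿ⁺¹` as a section: the retraction `k[X][I/Xᵢ] → k[X_j/Xᵢ : j ≠ i]`

Topic: `Literature/AlgebraicGeometry/Resolution`. Commutative algebra for the construction of
de Jong 1996, proof of Lemma 4.11 (p. 68): on the chart `Spec Cᵢ`, `Cᵢ = k[X₀, …, X_n][I/Xᵢ]`
(`PointBlowupAlgebraCharts.lean`), of the blow-up of `𝔸ⁿ⁺¹` in the origin, the exceptional
divisor is `V(Xᵢ) = Spec (Cᵢ/(Xᵢ)) ≅ Spec k[X_j/Xᵢ : j ≠ i]` (`PointBlowup.quotientBaseEquiv`),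
and the projection to `ℙⁿ` restricted to it is an isomorphism onto the chart `D₊(yᵢ)` — "the
exceptional divisor `E = b⁻¹(p) ≅ ℙ^d` being a section" of `q : P̃ → ℙ^d` (module docstring of
`AlterationsLemma411Projection.lean`; Eisenbud–Harris §9.3.2). In ring terms this is the
RETRACTION `sᵢ : Cᵢ → k[Y_j : j ≠ i]` of `βᵢ : Y_j ↦ X_j/Xᵢ` killing `Xᵢ`, PROVED here:

* `PointBlowup.sectRingHom n k i : Cᵢ → k[Y_j : j ≠ i]` — `Cᵢ → Cᵢ/(Xᵢ) ≅ k[Y]`;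
* `sectRingHom_baseHom` / `sectRingHom_comp_baseHom` — **`sᵢ ∘ βᵢ = id`** (a section of the
  projection on the chart);
* `sectRingHom_exc`, `sectRingHom_algebraMap_X` — `sᵢ(Xᵢ) = 0` and `sᵢ(X_j) = 0` for all `j` (the
  section lands in the exceptional divisor, i.e. over the origin), and `sectRingHom_algebraMap`:
  `sᵢ(p(X)) = p(0)` for `p ∈ k[X]`;
* `sectRingHom_frac` — `sᵢ(X_j/Xᵢ) = Y_j` (`j ≠ i`).

No named facts; [folklore] throughout.

## Sources

* A. J. de Jong, *Smoothness, semi-stability and alterations*, Publ. Math. IHÉS 83 (1996),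
  proof of Lemma 4.11, p. 68. [DeJong1996]
* D. Eisenbud, J. Harris, *3264 and All That* (2016), §9.3.2 (the exceptional divisor of the
  blow-up of `ℙⁿ` in a point is a section of the projection). [EisenbudHarris2016]
-/

noncomputable section

namespace Literature.AlgebraicGeometry.Resolution

universe u

namespace PointBlowup

variable (n : ℕ) (k : Type u) [CommRing k] (i : Fin (n + 1))

/-- **The retraction `sᵢ : Cᵢ = k[X][I/Xᵢ] → k[Y_j : j ≠ i]` killing `Xᵢ`**: the quotient map by
`(Xᵢ)` followed by the inverse of `k[Y] ≅ Cᵢ/(Xᵢ)` (`quotientBaseEquiv`). Geometrically: the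
inclusion of the exceptional divisor `V(Xᵢ) ≅ Spec k[Y] = D₊(yᵢ)` into the chart.
[cite: EisenbudHarris2016, §9.3.2] -/
def sectRingHom : Chart n k i →+* Base n k i :=
  (quotientBaseEquiv n k i).symm.toRingHom.comp (Ideal.Quotient.mk (Ideal.span {exc n k i}))

/-- **`sᵢ ∘ βᵢ = id`**: `sᵢ(βᵢ(b)) = b`. [folklore] -/
@[simp]
theorem sectRingHom_baseHom (b : Base n k i) : sectRingHom n k i (baseHom n k i b) = b := by
  rw [sectRingHom, RingHom.comp_apply, RingEquiv.toRingHom_eq_coe, RingEquiv.coe_toRingHom,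
    ← quotientBaseEquiv_apply, RingEquiv.symm_apply_apply]

/-- `sᵢ ∘ βᵢ = id` as ring homomorphisms. [folklore] -/
theorem sectRingHom_comp_baseHom :
    (sectRingHom n k i).comp (baseHom n k i).toRingHom = RingHom.id (Base n k i) :=
  RingHom.ext (sectRingHom_baseHom n k i)

/-- `sᵢ` is surjective. [folklore] -/
theorem sectRingHom_surjective : Function.Surjective (sectRingHom n k i) := fun b =>
  ⟨baseHom n k i b, sectRingHom_baseHom n k i b⟩

/-- **`sᵢ(Xᵢ) = 0`**: the section lies in the exceptional divisor. [folklore] -/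
@[simp]
theorem sectRingHom_exc : sectRingHom n k i (exc n k i) = 0 := by
  rw [sectRingHom, RingHom.comp_apply, Ideal.Quotient.eq_zero_iff_mem.mpr (Ideal.mem_span_singleton_self _),
    map_zero]

/-- `sᵢ(X_j/Xᵢ) = Y_j` for `j ≠ i`. [folklore] -/
theorem sectRingHom_frac {j : Fin (n + 1)} (hj : j ≠ i) :
    sectRingHom n k i (frac n k i j) = MvPolynomial.X ⟨j, hj⟩ := by
  rw [← baseHom_X n k i ⟨j, hj⟩, sectRingHom_baseHom]

/-- `sᵢ(Xᵢ/Xᵢ) = 1`. [folklore] -/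
theorem sectRingHom_frac_self : sectRingHom n k i (frac n k i i) = 1 := by
  rw [frac_self, map_one]

/-- **`sᵢ(X_j) = 0` for every `j`** (`X_j = Xᵢ · (X_j/Xᵢ)`): the section lies over the origin.
[folklore] -/
@[simp]
theorem sectRingHom_algebraMap_X (j : Fin (n + 1)) :
    sectRingHom n k i (algebraMap (R n k) (Chart n k i) (MvPolynomial.X j)) = 0 := by
  rw [algebraMap_X, map_mul, sectRingHom_exc, zero_mul]

/-- `sᵢ` on constants. [folklore] -/
@[simp]
theorem sectRingHom_algebraMap_C (c : k) :
    sectRingHom n k i (algebraMap (R n k) (Chart n k i) (MvPolynomial.C c)) = MvPolynomial.C c := by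
  have h : algebraMap (R n k) (Chart n k i) (MvPolynomial.C c) = baseHom n k i (MvPolynomial.C c) := by
    rw [baseHom_C, ← MvPolynomial.algebraMap_eq, ← IsScalarTower.algebraMap_apply]
  rw [h, sectRingHom_baseHom]

/-- **`sᵢ(p(X₀, …, X_n)) = p(0, …, 0)`**: on `k[X]` the retraction is evaluation at the origin
(`b ∘ s` is constant, equal to the blown-up point). [folklore] -/
theorem sectRingHom_algebraMap (p : R n k) :
    sectRingHom n k i (algebraMap (R n k) (Chart n k i) p) = MvPolynomial.C (MvPolynomial.constantCoeff p) := by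
  induction p using MvPolynomial.induction_on with
  | C c => rw [sectRingHom_algebraMap_C, MvPolynomial.constantCoeff_C]
  | add p q hp hq => rw [map_add, map_add, hp, hq, map_add, map_add]
  | mul_X p j hp => rw [map_mul, map_mul, hp, sectRingHom_algebraMap_X, mul_zero, map_mul,
      MvPolynomial.constantCoeff_X, mul_zero, map_zero]

/-- `sᵢ ∘ (k[X] → Cᵢ) = C ∘ (evaluation at the origin)` as ring homomorphisms. [folklore] -/
theorem sectRingHom_comp_algebraMap :
    (sectRingHom n k i).comp (algebraMap (R n k) (Chart n k i)) =
      MvPolynomial.C.comp (MvPolynomial.constantCoeff : R n k →+* k) :=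
  RingHom.ext (sectRingHom_algebraMap n k i)

/-- The kernel of `sᵢ` is `(Xᵢ)`. [folklore] -/
theorem ker_sectRingHom : RingHom.ker (sectRingHom n k i) = Ideal.span {exc n k i} := by
  ext c
  rw [RingHom.mem_ker, sectRingHom, RingHom.comp_apply, RingEquiv.toRingHom_eq_coe,
    RingEquiv.coe_toRingHom, map_eq_zero_iff _ (quotientBaseEquiv n k i).symm.injective,
    Ideal.Quotient.eq_zero_iff_mem]

end PointBlowup

end Literature.AlgebraicGeometry.Resolution

end
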